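import Summits.NavierStokesRegularity.NavierStokesRegularity.Theorems.StrainDoorsCompositionsB
import Summits.NavierStokesRegularity.NavierStokesRegularity.Theorems.StrainDoorsGrowth
import HarnessLib

/-!
# StrainDoorsViscous — door family S37 «StrainDoors», the VISCOUS-CREDIT family H⁺/Π⁺ (ref3 F1): texts + plate E1_S⁺ PROVED
# (§0⁺, §A, §4⁺, §2⁺, §3⁺ of nsreg-p1 g31's `r35/Sketch37c.lean` sha16 a97e15abb2eed89a, l.57–211 VERBATIM minus the by-name
# alias `strainGrowth_holds'`, which lives in `Theorems/StrainDoors.lean` as `strainGrowth_holds`)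

Landed by ns-s29-p2 g4 per planner nsreg-p1 g31's landing cut (ROUND-35 v1.2 f1dc5c3872e6b995; PLATE-AID-37 39463515597f0360)
under LEAD ns-s30-p1 g3, `--kind definition`, `--supports stmt-NavierStokesRegularity-0056 --as helper`.  Compositions, edges and
the closers of H⁺/Π⁺ land in `Theorems/StrainDoorsViscousCompositions.lean`.  The sketch's module docstring follows verbatim.

HONEST FRAME: threshold CRITERIA at the strain argmax of a HYPOTHETICAL first blow-up, net of viscous flattening
`ν·Δ_x⟪∇u ē, ē⟫ ≤ 0`; item 0056 `NoTypeII` and NS regularity are NOT proved; nothing here is a route or a summit statement.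
-/


/-!
# S37 «StrainDoors» v1.2 — the VISCOUS CREDIT (ref3 F1): doors H⁺ / Π⁺ and plate E1_S⁺ (PROVED here)

nsreg-p1 g31, ROUND-35 v1.2 (`HOME/ns-regularity-ideate-p1/r35/Sketch37c.lean`). Builds on the TREE: P0-37 parts 1–3
(`StrainDoorsDefs` p658273, `StrainDoorsCompositions` p658577, `StrainDoorsCompositionsB` p659168, ns-s29-p2 g4) and
E1_S `ArgmaxDoors.strainGrowth` (p658468, ns-sfl-p1 g5). Nothing of v1.0/v1.1 is restated.

REFEREE FINDING F1 (ref3 g27, SCORE-p1-ROUND-35-0828 §F1): at an exact strain argmax `(x̄, ē)` the plate E1_S discards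
the viscous term `ν·Δ_x⟪∇u ē, ē⟫(x̄) ≤ 0`; keeping it is FREE (it is `≤ 0` by the second-order condition, and it is
exactly `⟪ν D(Δu)(x̄) ē, ē⟫`, the viscous term of the strain equation paired with `ē ⊗ ē`). The strengthened doors
charge `(T − t)²·(H + ν·Δ_x⟪∇u ē,ē⟫(x̄)) ≤ c` instead of `(T − t)²·H ≤ c` — a WEAKER hypothesis, hence STRONGER
criteria (`H⁺ ⇒ H`, `Π⁺ ⇒ Π`, proved below), the strain twin of S35-B's twist credit `−ν|∇ξ|²|ω|`.

CONTENTS. §0⁺ `strainLap u t x e := Δ_x (y ↦ ⟪∇u(t,y) e, e⟫) (x)`. §A two identities factored out of sfl's E1_S proof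
with Fermat replaced by a CRITICAL-POINT hypothesis: `⟪D(Δv)(x₀)e, e⟫ = Δ(y ↦ ⟪∇v(y)e,e⟫)(x₀)` and
`⟪D²v(x₀)(e)(a), e⟫ = 0` when `D_x⟪∇v e, e⟫(x₀) = 0`. §4⁺ plate E1_S⁺ «StrainGrowthViscous» — E1_S with the Laplacian
KEPT, hypothesis only «`x₀` is a critical point of `y ↦ ⟪∇v(y)e₀,e₀⟫`», ANY real `ν` — **PROVED**
(`strainGrowthViscous_holds`), and the edge `StrainGrowthViscous → StrainGrowth`. §2⁺/§3⁺ doors H⁺ «StrainFeedingViscousDoor»,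
Π⁺ «PressureFocusingViscousDoor». §6⁺ the two-slab barrier of `strainFeedingDoor_of` factored as `strainDoor_of_growth`
(Steps 1–5 VERBATIM, the Riccati inequality at the charged argmaxes as the hypothesis `hgrowth`) and
`strainFeedingViscousDoor_of : StrainGrowthViscous → StrainFrame → StrainThreshold → SubcriticalStrainDoor → H⁺`.
§7⁺ `Π⁺ ⇐ PoissonTrace + H⁺`. §8⁺ edges `H⁺ → H`, `Π⁺ → Π` and the closers: **`strainFeedingViscousDoor_of_decay :
GradientUniformDecay → StrainFeedingViscousDoor`**, `pressureFocusingViscousDoor_of_decay`, and — E1_S being in the tree —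
`strainFeedingDoor_of_decay : GradientUniformDecay → StrainFeedingDoor`, `pressureFocusingDoor_of_decay`: ALL FOUR EXACT
DOORS ARE `GradientUniformDecay` (D_S) AWAY FROM UNCONDITIONAL — and §9⁺ (v2 of this file, after sfl's p659680
`ArgmaxDoors.gradientUniformDecay` LANDED 19:05Z): **`strainFeedingViscousDoor_holds`, `pressureFocusingViscousDoor_holds` —
doors H⁺ / Π⁺ CLOSED, unconditional** (H / Π likewise; their `_holds` are ns-s29-p2's `Theorems/StrainDoors.lean`).

HONEST LABEL: regularity CRITERIA (threshold doors); E1_S⁺ is the printed strain-eigenvalue identity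
(Carbone–Iovieno–Bragg 2020 §2.1, Buaria–Pumir–Bodenschatz 2022 eq. (15)) read at a critical point of the Rayleigh
quotient with `e` frozen. WHAT THIS IS NOT: item 0056 `NoTypeII` / NS regularity are NOT proved; no Literature fact is a
hypothesis; nothing here is a route or a summit statement (`--supports stmt-NavierStokesRegularity-0056 --as helper`).
-/

noncomputable section

open MeasureTheory Set Function Filter Metric Real InnerProductSpace
open _root_.Topology
open scoped ENNReal NNReal RealInnerProductSpace ContDiff Laplacian
open Literature.Analysis Literature.Analysis.FluidPDE
open Literature.Analysis.FluidPDE.VorticityDirectionDynamics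

set_option linter.dupNamespace false

namespace Summit.NavierStokesRegularity.NavierStokesRegularity.Theorems.StrainDoors

open Summit.NavierStokesRegularity.NavierStokesRegularity.Theorems.ArgmaxDoors

-- nested operator types (second derivatives)
set_option maxSynthPendingDepth 3
/-! ## §0⁺ The Laplacian of the strain form -/

/-- support (definition): `strainLap u t x e := Δ_x (y ↦ ⟪∇u(t,y) e, e⟫) (x)`, the spatial Laplacian of the strain
form at the frozen direction `e`. At a strain argmax it is `≤ 0` (second-order condition); `ν·strainLap` is exactly
the viscous term `⟪ν D(Δu)(t,x) e, e⟫` of the strain equation paired with `e ⊗ e` (§A). -/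
def strainLap (u : ℝ → (EuclideanSpace ℝ (Fin 3)) → (EuclideanSpace ℝ (Fin 3))) (t : ℝ)
    (x e : EuclideanSpace ℝ (Fin 3)) : ℝ :=
  (Δ (fun y => strainQuad u t y e)) x

/-! ## §A Two identities (sfl's E1_S lemmas with Fermat factored out) -/

/-- `⟪D(Δv)(x₀) e, e⟫ = Δ(y ↦ ⟪∇v(y) e, e⟫)(x₀)` for smooth `v`: third derivatives commute
(`fderiv_laplacian_apply_of_contDiff_three`) and the pairing with the constant `e ⊗ e` passes through `Δ`
(`ContDiffAt.laplacian_CLM_comp_left`). [folklore] -/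
theorem inner_fderiv_laplacian_eq_laplacian_strain
    {v : EuclideanSpace ℝ (Fin 3) → EuclideanSpace ℝ (Fin 3)} (hv : ContDiff ℝ ∞ v)
    (x₀ e : EuclideanSpace ℝ (Fin 3)) :
    ⟪fderiv ℝ (Δ v) x₀ e, e⟫ = (Δ (fun y => ⟪fderiv ℝ v y e, e⟫)) x₀ := by
  have hv3 : ContDiff ℝ 3 v := hv.of_le (by norm_cast)
  have hg : ContDiff ℝ 2 (fun y => fderiv ℝ v y e) :=
    ((hv.of_le (by norm_cast) : ContDiff ℝ 3 v).fderiv_right (m := 2) (by norm_cast)).clm_apply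
      contDiff_const
  rw [fderiv_laplacian_apply_of_contDiff_three hv3 x₀ e, real_inner_comm]
  have h1 : ⟪e, Δ (fun y => fderiv ℝ v y e) x₀⟫ = Δ (fun y => ⟪e, fderiv ℝ v y e⟫) x₀ :=
    ((hg.contDiffAt (x := x₀)).laplacian_CLM_comp_left (l := innerSL ℝ e)).symm
  have hfun : (fun y => ⟪e, fderiv ℝ v y e⟫) = (fun y => ⟪fderiv ℝ v y e, e⟫) :=
    funext fun y => real_inner_comm _ _
  rw [h1, hfun]

/-- At a CRITICAL point `x₀` of `y ↦ ⟪∇v(y) e, e⟫` the transport term vanishes in every direction `a`: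
`⟪D²v(x₀)(e)(a), e⟫ = ⟪D²v(x₀)(a)(e), e⟫ = D_x⟪∇v e, e⟫(x₀) a = 0` (Schwarz + chain rule). [folklore] -/
theorem inner_fderiv_fderiv_apply_eq_zero_of_fderiv_eq_zero
    {v : EuclideanSpace ℝ (Fin 3) → EuclideanSpace ℝ (Fin 3)} (hv : ContDiff ℝ ∞ v)
    (x₀ e a : EuclideanSpace ℝ (Fin 3))
    (hcrit : fderiv ℝ (fun y => ⟪fderiv ℝ v y e, e⟫) x₀ = 0) :
    ⟪fderiv ℝ (fderiv ℝ v) x₀ e a, e⟫ = 0 := by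
  have hv2 : ContDiff ℝ 2 v := hv.of_le (by norm_cast)
  have hD1 : ContDiff ℝ 1 (fderiv ℝ v) := hv2.fderiv_right (m := 1) (by norm_cast)
  have hD1d : DifferentiableAt ℝ (fderiv ℝ v) x₀ := (hD1.differentiable one_ne_zero) x₀
  -- Schwarz
  have hsymm : fderiv ℝ (fderiv ℝ v) x₀ e a = fderiv ℝ (fderiv ℝ v) x₀ a e :=
    (hv2.contDiffAt.isSymmSndFDerivAt (by simp [minSmoothness_of_isRCLikeNormedField])).eq e a
  rw [hsymm]
  have hg : DifferentiableAt ℝ (fun y => fderiv ℝ v y e) x₀ := hD1d.clm_apply (differentiableAt_const e)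
  have hW : HasFDerivAt (fun y => ⟪e, fderiv ℝ v y e⟫)
      ((innerSL ℝ e).comp (fderiv ℝ (fun y => fderiv ℝ v y e) x₀)) x₀ :=
    (innerSL ℝ e).hasFDerivAt.comp x₀ hg.hasFDerivAt
  have hfun : (fun y => ⟪e, fderiv ℝ v y e⟫) = (fun y => ⟪fderiv ℝ v y e, e⟫) :=
    funext fun y => real_inner_comm _ _
  have h0 : (innerSL ℝ e).comp (fderiv ℝ (fun y => fderiv ℝ v y e) x₀) = 0 := by
    rw [← hW.fderiv, hfun, hcrit]
  have h0a := congrArg (fun L : EuclideanSpace ℝ (Fin 3) →L[ℝ] ℝ => L a) h0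
  simp only [ContinuousLinearMap.coe_comp, comp_apply, innerSL_apply_apply,
    zero_apply] at h0a
  rw [fderiv_apply_const_apply hD1d e a] at h0a
  rw [real_inner_comm]
  exact h0a

/-! ## §4⁺ Plate E1_S⁺ «StrainGrowthViscous» (PROVED) -/

/-- plate E1_S⁺ «StrainGrowthViscous» (M; E1_S with the viscous term KEPT). `ν` ANY real, `v` smooth, `q` any scalar
field, `|e₀| = 1`, `x₀` a CRITICAL POINT of `y ↦ ⟪∇v(y) e₀, e₀⟫` (no maximality); if `w + D((v·∇)v)(x₀)e₀ =
ν D(Δv)(x₀)e₀ − D(∇q)(x₀)e₀` then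
`⟪w, e₀⟫ ≤ −⟪∇v(x₀)e₀,e₀⟫² + ¼(|ω(x₀)|² − ⟪ω(x₀),e₀⟫²) − ⟪D(∇q)(x₀)e₀, e₀⟫ + ν·Δ(y ↦ ⟪∇v(y)e₀,e₀⟫)(x₀)`.
(It is an identity up to the matrix step `⟪A²e,e⟫ ≥ ⟪Ae,e⟩² − ¼|ω × e|²`.) E1_S = E1_S⁺ + «`Δ ≤ 0` at a maximum» +
`ν ≥ 0` (`strainGrowth_of_viscous`). [printed identity: Carbone–Iovieno–Bragg, JFM 900 (2020) §2.1;
Buaria–Pumir–Bodenschatz, Phil. Trans. A 380 (2022) eq. (15)] -/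
def StrainGrowthViscous : Prop :=
  ∀ (ν : ℝ) (v : (EuclideanSpace ℝ (Fin 3)) → (EuclideanSpace ℝ (Fin 3))) (q : (EuclideanSpace ℝ (Fin 3)) → ℝ),
    ContDiff ℝ ∞ v →
    ∀ (x₀ e₀ : EuclideanSpace ℝ (Fin 3)), ‖e₀‖ = 1 →
      fderiv ℝ (fun y => ⟪fderiv ℝ v y e₀, e₀⟫) x₀ = 0 →
      ∀ w : EuclideanSpace ℝ (Fin 3),
        w + fderiv ℝ (convect v v) x₀ e₀ = ν • fderiv ℝ (Δ v) x₀ e₀ - fderiv ℝ (gradient q) x₀ e₀ →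
        ⟪w, e₀⟫ ≤ -⟪fderiv ℝ v x₀ e₀, e₀⟫ ^ 2 + (1 / 4) * (‖curl v x₀‖ ^ 2 - ⟪curl v x₀, e₀⟫ ^ 2) -
          ⟪fderiv ℝ (gradient q) x₀ e₀, e₀⟫ + ν * (Δ (fun y => ⟪fderiv ℝ v y e₀, e₀⟫)) x₀

/-- **Plate E1_S⁺ PROVED** (sfl's `strainGrowth` proof with Fermat replaced by the critical-point hypothesis and the
Laplacian term kept as an identity). -/
theorem strainGrowthViscous_holds : StrainGrowthViscous := by
  intro ν v q hv x₀ e₀ he₀ hcrit w hw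
  have hv2 : ContDiff ℝ 2 v := hv.of_le (by norm_cast)
  have hvd : Differentiable ℝ v :=
    (hv.of_le (by norm_cast) : ContDiff ℝ 1 v).differentiable one_ne_zero
  have hD1 : ContDiff ℝ 1 (fderiv ℝ v) := hv2.fderiv_right (m := 1) (by norm_cast)
  have hD1d : DifferentiableAt ℝ (fderiv ℝ v) x₀ := (hD1.differentiable one_ne_zero) x₀
  -- the product rule for the convective term
  have hconv : convect v v = fun y => fderiv ℝ v y (v y) := rfl
  have hprod : fderiv ℝ (convect v v) x₀ e₀ =
      fderiv ℝ (fderiv ℝ v) x₀ e₀ (v x₀) + fderiv ℝ v x₀ (fderiv ℝ v x₀ e₀) := by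
    rw [hconv, fderiv_clm_apply hD1d (hvd x₀)]
    simp only [add_apply, ContinuousLinearMap.coe_comp, comp_apply,
      ContinuousLinearMap.flip_apply]
    rw [add_comm]
  -- solve for `w`
  have hw' : w = ν • fderiv ℝ (Δ v) x₀ e₀ - fderiv ℝ (gradient q) x₀ e₀ -
      (fderiv ℝ (fderiv ℝ v) x₀ e₀ (v x₀) + fderiv ℝ v x₀ (fderiv ℝ v x₀ e₀)) := by
    rw [← hprod, ← hw]; abel
  rw [hw', inner_sub_left, inner_sub_left, inner_add_left, real_inner_smul_left,
    inner_fderiv_fderiv_apply_eq_zero_of_fderiv_eq_zero hv x₀ e₀ (v x₀) hcrit, zero_add,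
    inner_fderiv_laplacian_eq_laplacian_strain hv x₀ e₀]
  have h2 := neg_inner_fderiv_fderiv_le v x₀ e₀ he₀
  linarith

/-- **E1_S⁺ ⇒ E1_S**: at a global maximum, Fermat gives the critical point and the second-order condition gives
`Δ(y ↦ ⟪∇v(y)e₀,e₀⟫)(x₀) ≤ 0`, so for `ν ≥ 0` the kept term is a credit that may be dropped. -/
theorem strainGrowth_of_viscous (hV : StrainGrowthViscous) : StrainGrowth := by
  intro ν hν v q hv x₀ e₀ he₀ hmax w hw
  have hloc : IsLocalMax (fun y => ⟪fderiv ℝ v y e₀, e₀⟫) x₀ :=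
    Filter.Eventually.of_forall fun y => hmax y
  have hcrit : fderiv ℝ (fun y => ⟪fderiv ℝ v y e₀, e₀⟫) x₀ = 0 := hloc.fderiv_eq_zero
  have h := hV ν v q hv x₀ e₀ he₀ hcrit w hw
  have h1 := inner_fderiv_laplacian_le_zero_of_isMax hv x₀ e₀ hmax
  rw [inner_fderiv_laplacian_eq_laplacian_strain hv x₀ e₀] at h1
  have h3 : ν * (Δ (fun y => ⟪fderiv ℝ v y e₀, e₀⟫)) x₀ ≤ 0 := mul_nonpos_of_nonneg_of_nonpos hν h1
  linarith


/-! ## §2⁺ Door S37-H⁺ «StrainFeedingViscousDoor» -/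

/-- door S37-H⁺ «StrainFeedingViscousDoor» (regularity criterion; door H with the viscous credit kept). Same constants
and frame as door H (`ν > 0`, `0 ≤ t₀ < T`, `0 < y₀ < 1`, `c < y₀(1+y₀)`); charged at the same strain argmaxes above
the line `(T − t)⟪∇u ē,ē⟫ > y₀`, but the charge is `(T − t)²·(H + ν·Δ_x⟪∇u ē,ē⟫(x̄)) ≤ c` with
`H = ¼(|ω|² − ⟪ω,ē⟫²) − ∇²p(ē,ē)` — since `Δ_x⟪∇u ē,ē⟫(x̄) ≤ 0` at an argmax this is a WEAKER hypothesis than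
door H's (`strainFeedingDoor_of_viscousDoor : H⁺ → H`): a blow-up must keep `H − ν|Δ_x⟪∇u ē,ē⟫|` (feed net of
local viscous smoothing of the strain peak) above `≈ (2 − credit)/(T−t)²`. -/
def StrainFeedingViscousDoor : Prop :=
  ∀ (ν T t₀ y₀ c : ℝ), 0 < ν → 0 ≤ t₀ → t₀ < T → 0 < y₀ → y₀ < 1 → c < y₀ * (1 + y₀) →
    ∀ (u : ℝ → (EuclideanSpace ℝ (Fin 3)) → (EuclideanSpace ℝ (Fin 3)))
      (p : ℝ → (EuclideanSpace ℝ (Fin 3)) → ℝ),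
      IsClassicalNSSolutionOn (Ico 0 T) ν 0 u p →
      (∀ T'' < T, HasBoundedSobolevNormsOn (Icc 0 T'') u) →
      (∀ t ∈ Ico t₀ T, ∀ (x e : EuclideanSpace ℝ (Fin 3)), IsStrainArgmax u t x e →
        y₀ < (T - t) * strainQuad u t x e →
        (T - t) ^ 2 * (strainFeed u p t x e + ν * strainLap u t x e) ≤ c) →
      HasSobolevExtensionPast ν u T

/-! ## §3⁺ Door S37-Π⁺ «PressureFocusingViscousDoor» -/

/-- door S37-Π⁺ «PressureFocusingViscousDoor» (regularity criterion; door Π with the viscous credit kept): charged at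
the same strain argmaxes, `(T − t)²·(⅓|S|² + (1/12)|ω|² − ¼⟪ω,ē⟫² − Π(ē,ē) + ν·Δ_x⟪∇u ē,ē⟫(x̄)) ≤ c`. -/
def PressureFocusingViscousDoor : Prop :=
  ∀ (ν T t₀ y₀ c : ℝ), 0 < ν → 0 ≤ t₀ → t₀ < T → 0 < y₀ → y₀ < 1 → c < y₀ * (1 + y₀) →
    ∀ (u : ℝ → (EuclideanSpace ℝ (Fin 3)) → (EuclideanSpace ℝ (Fin 3)))
      (p : ℝ → (EuclideanSpace ℝ (Fin 3)) → ℝ),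
      IsClassicalNSSolutionOn (Ico 0 T) ν 0 u p →
      (∀ T'' < T, HasBoundedSobolevNormsOn (Icc 0 T'') u) →
      (∀ t ∈ Ico t₀ T, ∀ (x e : EuclideanSpace ℝ (Fin 3)), IsStrainArgmax u t x e →
        y₀ < (T - t) * strainQuad u t x e →
        (T - t) ^ 2 * ((1 / 3) * strainNormSq u t x + (1 / 12) * ‖curl (u t) x‖ ^ 2 -
          (1 / 4) * ⟪curl (u t) x, e⟫ ^ 2 - devPressureHess p t x e + ν * strainLap u t x e) ≤ c) →
      HasSobolevExtensionPast ν u T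

end Summit.NavierStokesRegularity.NavierStokesRegularity.Theorems.StrainDoors

end
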